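import Summits.PneNP.PneNP.Theorems.ChebyshevTracialDesignCrossingPin
import HarnessLib

/-!
# Cell pnp-psdrank, route `ChebyshevTracialDesign`: the crossing-pin lemma for WEIGHTED rectangles — test functions supported on the
# cuts crossed by an edge, against matching weights supported on the matchings containing it

Harmonic backbone of the crux `TracialDecayExp20` (stmt-PneNP-19878), brick 24a (prover g7). Brick 23b (`…CrossingPin.crossingPin_value_le`)
is the `0/1` case; here the same mechanism is run for a general test function `f` on the `t`-cuts with `f(U) = 0` unless `{a,b}` crosses `U`
and general weights `y` on the perfect matchings with `y(M) = 0` unless `{a,b} ∈ M` — the input of the TRACIAL (psd, every dimension `r`)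
crossing-pin lemma (`…CrossingPinTracial`, entry by entry):
* `weighted_lowDegree_value_eq` — an exact design of degree `D` prices `zeta q ⊗ y` (any `q` supported on `|A| ≤ D`, any `y`) EXACTLY at
  `−(1/|PM|)·Σ_M y(M)·Ẽ_M[zeta q]` (the weighted form of brick 14);
* `crossingPin_weighted_value_le` — **`|Σ_U Σ_M W(U,M)·f(U)·y(M)| ≤ (Σ_c|w_c|)·√(P_{D−4}·(‖f‖²/C(n,t))·(‖y‖²/|PM|))`** for every exact
  design of degree `4 ≤ D < t`.
[cite: Rothvoss2017, §2 and Lemma 7 (PDF pp. 6–8)] [cite: Grigoriev2001, §1 and Lemma 1.4 (PDF p. 8)]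
[cite: LeePrakashDewolfYuen2016, App. B Lemma B.8, B.10 (arXiv text chunk 21)]
Stature: support/instrument. WHAT THIS IS NOT: not the r = 1 rung, nothing on psd rank, no P-vs-NP content. Supports stmt-PneNP-19878.
-/

set_option linter.dupNamespace false -- `Summit.PneNP.PneNP.…`: summit = sub-problem (D-0017)

noncomputable section

namespace Summit.PneNP.PneNP.Theorems.ChebyshevTracialDesignCrossingPinWeighted

open Finset Polynomial Literature.Barriers.PneNP Literature.Combinatorics.Optimization Literature.Computability.Complexity
open Literature.Combinatorics.SimpleGraph.CycleSpace
open Literature.Combinatorics.AssociationSchemes Literature.Combinatorics.AssociationSchemes.JohnsonHarmonics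
open Literature.Combinatorics.AssociationSchemes.JohnsonSpectrum
open Summit.PneNP.PneNP.Theorems.ChebyshevTracialDesignLevelTail
open Summit.PneNP.PneNP.Theorems.ChebyshevTracialDesignLevelNormalisation
open Summit.PneNP.PneNP.Theorems.ChebyshevTracialDesignProfilePolynomial
open Summit.PneNP.PneNP.Theorems.ChebyshevTracialDesignProfileExtrapolation
open Summit.PneNP.PneNP.Theorems.ChebyshevTracialDesignVirtualValueUnique
open Summit.PneNP.PneNP.Theorems.ChebyshevTracialDesignCrossingPinAlgebra
open Summit.PneNP.PneNP.Theorems.ChebyshevTracialDesignCrossingPin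

variable {n : ℕ}

/-! ### §1 An exact design prices `zeta q ⊗ y` at the averaged pseudo-expectation (weighted brick 14) -/

/-- **Weighted exact pricing of a low-degree test function**: for `n` even, an exact design `(n, t = 2c'+1, T, D, B, C, w)`, a coefficient
vector `q` supported on sets of size `≤ D` and ANY weights `y`:
`Σ_U Σ_M levelWeight(U,M)·zeta q (U)·y(M) = −(1/|PM|)·Σ_M y(M)·Σ_{|A|≤D} q_A·knapsackMoment(|M|, t/2, |M[A]|)`.
[cite: Rothvoss2017, §2 (PDF p. 6)] [cite: Grigoriev2001, Lemma 1.4 (PDF p. 8)] -/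
theorem weighted_lowDegree_value_eq {c' T D : ℕ} {Bv : ℝ} {C : Finset ℕ} {w : ℕ → ℝ} (hn : Even n)
    (hdes : IsExactDesign n (2 * c' + 1) T D Bv C w) (q : Finset (Fin n) → ℝ)
    (hq : ∀ A : Finset (Fin n), D < A.card → q A = 0) (y : PMatch n → ℝ) :
    ∑ U : OddSet n, ∑ M : PMatch n, levelWeight n (2 * c' + 1) C w U M * (zeta q U.1 * y M) =
      -((Fintype.card (PMatch n) : ℝ)⁻¹ * ∑ M : PMatch n, y M * ∑ A : {A : Finset (Fin n) // A.card ≤ D},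
        q A.1 * knapsackMoment M.1.card (((2 * c' + 1 : ℕ) : ℝ) / 2) (M.1.filter fun e => ∃ a ∈ A.1, a ∈ e).card) := by
  classical
  have hC := hdes.2.2.2.1
  have hexact := hdes.2.2.2.2.2.1
  have hPm : (0 : ℝ) < Fintype.card (PMatch n) := by exact_mod_cast card_pmatch_pos hn
  obtain ⟨P, hPdeg, hP0, hPval⟩ := exists_weighted_levelPoly_zeta (D := D) (⟨c', rfl⟩ : Odd (2 * c' + 1)) y q hq
  rw [value_eq_level_sums, ← hP0]
  have hterm : ∀ c ∈ C, w c / ((Qset n (2 * c' + 1) c).card : ℝ) *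
      ∑ M : PMatch n, ∑ U : OddSet n, (if U.1.card = 2 * c' + 1 ∧ cc U M = c then zeta q U.1 * y M else 0) =
      (Fintype.card (PMatch n) : ℝ)⁻¹ * (w c * P.eval (c : ℝ)) := by
    intro c hc
    obtain ⟨⟨m, hm⟩, -, hcT, hne⟩ := hC c hc
    have hmc : m ≤ c' := by have := hdes.2.2.1; omega
    have hQ := card_Qset_eq (n := n) hmc
    have hQpos : (0 : ℝ) < ((Qset n (2 * c' + 1) c).card : ℝ) := by exact_mod_cast card_pos.2 hne
    rw [level_sum_product_eq ⟨c', rfl⟩ c (zeta q) y, hm, hPval (2 * m + 1) (c' - m) (by omega), hQ]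
    rw [hm, hQ] at hQpos
    have hN : (0 : ℝ) < (((n / 2).choose (2 * m + 1 + (c' - m)) * (2 * m + 1 + (c' - m)).choose (c' - m) * 2 ^ (2 * m + 1) : ℕ) : ℝ) :=
      pos_of_mul_pos_right hQpos hPm.le
    field_simp
  rw [sum_congr rfl hterm, ← mul_sum, hexact P hPdeg]
  ring

/-! ### §2 The weighted crossing-pin lemma -/

/-- **The weighted crossing-pin lemma.** For `n` even, an exact design `(n, t = 2c'+1, T, D, B, C, w)` with `4 ≤ D < t`, an edge `{a,b}`,
a test function `f` on the `t`-subsets with `f(U) = 0` unless `{a,b}` crosses `U` (and `f = 0` off the `t`-subsets), and weights `y` on the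
perfect matchings with `y(M) = 0` unless `{a,b} ∈ M`:
`|Σ_U Σ_M levelWeight(U,M)·f(U)·y(M)| ≤ (Σ_{c∈C}|w_c|)·√(P_{D−4}·(Σ_{|U|=t} f(U)²/C(n,t))·(Σ_M y(M)²/|PM|))`.
[cite: Rothvoss2017, §2 and Lemma 7 (PDF pp. 6–8)] [cite: Grigoriev2001, Lemma 1.4 (PDF p. 8)] -/
theorem crossingPin_weighted_value_le {c' T D : ℕ} {Bv : ℝ} {C : Finset ℕ} {w : ℕ → ℝ} (hn : Even n)
    (hdes : IsExactDesign n (2 * c' + 1) T D Bv C w) (hD : D ≤ 2 * c') (hD4 : 4 ≤ D) (a b : Fin n)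
    (f : Finset (Fin n) → ℝ) (hfhom : IsHomog (2 * c' + 1) f) (hfχ : ∀ U, ¬ Crosses U s(a, b) → f U = 0)
    (y : PMatch n → ℝ) (hy : ∀ M : PMatch n, s(a, b) ∉ M.1 → y M = 0) :
    |∑ U : OddSet n, ∑ M : PMatch n, levelWeight n (2 * c' + 1) C w U M * (f U.1 * y M)| ≤
      (∑ c ∈ C, |w c|) * Real.sqrt ((∏ i ∈ range ((D - 4) / 2 + 1), ((2 * i + 1 : ℝ) / ((n : ℝ) - 2 * i))) *
        ((∑ U ∈ univ.powersetCard (2 * c' + 1), f U ^ 2) / (n.choose (2 * c' + 1) : ℝ)) *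
        ((∑ M : PMatch n, y M ^ 2) / (Fintype.card (PMatch n) : ℝ))) := by
  classical
  have ht : 2 * (2 * c' + 1) + 2 ≤ n := hdes.2.1
  have htn : 2 * (2 * c' + 1) ≤ n + 1 := by omega
  have ht2 : 2 * (2 * c' + 1) ≤ n := by omega
  obtain ⟨p, hp, hfp⟩ := exists_ladder_decomposition htn hfhom
  -- the low part at degree `K = D − 2` and its coefficient vector
  set K := D - 2 with hK
  set q : Finset (Fin n) → ℝ :=
    ∑ j ∈ range (2 * c' + 1 + 1), ((2 * c' + 1 - j).factorial : ℝ) • (if K < j then 0 else p j) with hq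
  obtain ⟨U₀, hU₀⟩ : ∃ U : Finset (Fin n), U ∈ univ.powersetCard (2 * c' + 1) := by
    have : (univ.powersetCard (2 * c' + 1) : Finset (Finset (Fin n))).Nonempty := by
      apply powersetCard_nonempty.2; rw [card_univ, Fintype.card_fin]; omega
    exact this
  have hq0 : ∀ A : Finset (Fin n), K < A.card → q A = 0 :=
    fun A hA => (lowPart_apply_eq_zeta K p hp (mem_powersetCard.1 hU₀).2).2 A hA
  -- the χ-multiple of the low part: priced exactly at zero against `y`
  set r : Finset (Fin n) → ℝ := fun B => (if a ∈ B then q B + q (B.erase a) else 0) +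
      (if b ∈ B then q B + q (B.erase b) else 0) -
      2 * (if a ∈ B then (if b ∈ B then q B + q (B.erase b) else 0) +
        (if b ∈ B.erase a then q (B.erase a) + q ((B.erase a).erase b) else 0) else 0) with hr
  have hr0 : ∀ B : Finset (Fin n), D < B.card → r B = 0 := fun B hB => by
    rw [hr]; exact mulCross_eq_zero_of_card a b q hq0 B (by omega)
  have hprice : ∑ U : OddSet n, ∑ M : PMatch n, levelWeight n (2 * c' + 1) C w U M * (zeta r U.1 * y M) = 0 := by
    rw [weighted_lowDegree_value_eq hn hdes r hr0 y]
    have hM : ∀ M : PMatch n, y M * ∑ A : {A : Finset (Fin n) // A.card ≤ D},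
        r A.1 * knapsackMoment M.1.card (((2 * c' + 1 : ℕ) : ℝ) / 2) (M.1.filter fun e => ∃ v ∈ A.1, v ∈ e).card = 0 := by
      intro M
      by_cases heM : s(a, b) ∈ M.1
      · have hfull : ∑ B : Finset (Fin n),
            r B * knapsackMoment M.1.card (((2 * c' + 1 : ℕ) : ℝ) / 2) (M.1.filter fun e => ∃ v ∈ B, v ∈ e).card = 0 :=
          knapsack_sum_mulCross_eq_zero M heM q (((2 * c' + 1 : ℕ) : ℝ) / 2)
        have hsub : ∑ A : {A : Finset (Fin n) // A.card ≤ D},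
            r A.1 * knapsackMoment M.1.card (((2 * c' + 1 : ℕ) : ℝ) / 2) (M.1.filter fun e => ∃ v ∈ A.1, v ∈ e).card = 0 := by
          rw [← sum_subtype (univ.filter fun A : Finset (Fin n) => A.card ≤ D) (by simp)
            (fun A => r A * knapsackMoment M.1.card (((2 * c' + 1 : ℕ) : ℝ) / 2) (M.1.filter fun e => ∃ v ∈ A, v ∈ e).card)]
          rw [← hfull]
          refine sum_subset (filter_subset _ _) fun A _ hA => ?_
          rw [mem_filter, not_and] at hA
          rw [hr0 A (by have := hA (mem_univ _); omega), zero_mul]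
        rw [hsub, mul_zero]
      · rw [hy M heM, zero_mul]
    rw [Fintype.sum_congr _ _ hM, sum_const_zero, mul_zero, neg_zero]
  -- the χ-multiple of the high part: all layers `≤ D − 4` vanish
  set F : Finset (Fin n) → ℝ := ∑ j ∈ range (2 * c' + 1 + 1), up^[2 * c' + 1 - j] (if K < j then p j else 0) with hF
  set G : Finset (Fin n) → ℝ := fun U => (if Crosses U s(a, b) then (1 : ℝ) else 0) * F U with hGdef
  have hFhom : IsHomog (2 * c' + 1) F := isHomog_ladderSum _ (isHarmonic_ite_high p hp)
  have hGhom : IsHomog (2 * c' + 1) G := fun U hU => by rw [hGdef]; dsimp only; rw [hFhom U hU, mul_zero]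
  obtain ⟨g, hg, hGg⟩ := exists_ladder_decomposition htn hGhom
  have hg0 : ∀ j, j + 2 ≤ K → g j = 0 := fun j hj =>
    crossHigh_layer_eq_zero (K := K) ht2 hj (by omega) p hp a b g hg fun U _ => by rw [← hGg]
  -- on the `t`-sets: `f = zeta r + G`
  have hsplit : ∀ (U : OddSet n) (M : PMatch n), levelWeight n (2 * c' + 1) C w U M * (f U.1 * y M) =
      levelWeight n (2 * c' + 1) C w U M * (zeta r U.1 * y M) + levelWeight n (2 * c' + 1) C w U M * (G U.1 * y M) := by
    intro U M
    by_cases hU : U.1.card = 2 * c' + 1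
    · have hlow := (lowPart_apply_eq_zeta K p hp hU).1
      have hfU : f U.1 = zeta q U.1 + F U.1 := by
        rw [hfp, ladderSum_eq_low_add_high K p, Pi.add_apply, hlow]
      have hχ : f U.1 = (if Crosses U.1 s(a, b) then (1 : ℝ) else 0) * f U.1 := by
        by_cases hc : Crosses U.1 s(a, b)
        · rw [if_pos hc, one_mul]
        · rw [hfχ U.1 hc, mul_zero]
      rw [← mul_add, ← add_mul, hr, zeta_mulCross_apply a b q U.1, hGdef]
      dsimp only
      rw [hχ, hfU]
      split_ifs <;> ring
    · have h0 : levelWeight n (2 * c' + 1) C w U M = 0 := by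
        rw [levelWeight]
        exact sum_eq_zero fun c _ => by rw [if_neg (fun h => hU (mem_Qset_iff.1 h).1)]
      rw [h0]; ring
  have hV : ∑ U : OddSet n, ∑ M : PMatch n, levelWeight n (2 * c' + 1) C w U M * (f U.1 * y M) =
      ∑ U : OddSet n, ∑ M : PMatch n, levelWeight n (2 * c' + 1) C w U M * (G U.1 * y M) := by
    rw [show (∑ U : OddSet n, ∑ M : PMatch n, levelWeight n (2 * c' + 1) C w U M * (G U.1 * y M)) =
        ∑ U : OddSet n, ∑ M : PMatch n, levelWeight n (2 * c' + 1) C w U M * (zeta r U.1 * y M) +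
          ∑ U : OddSet n, ∑ M : PMatch n, levelWeight n (2 * c' + 1) C w U M * (G U.1 * y M) by rw [hprice, zero_add],
      ← sum_add_distrib]
    refine Fintype.sum_congr _ _ fun U => ?_
    rw [← sum_add_distrib]
    exact sum_congr rfl fun M _ => hsplit U M
  -- brick 19 at degree `D − 4` for `G ⊗ y`: the virtual term vanishes since the layers `≤ D − 4` of `G` do
  have hdes' : IsExactDesign n (2 * c' + 1) T (D - 4) Bv C w := isExactDesign_of_le hdes (by omega)
  have hGdec : ∀ U ∈ univ.powersetCard (2 * c' + 1), G U = (∑ j ∈ range (2 * c' + 1 + 1), up^[2 * c' + 1 - j] (g j)) U :=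
    fun U _ => by rw [← hGg]
  have htr := weighted_value_truncation_explicit hn hdes' (by omega) G g hg hGdec y
  have hqG : (∑ j ∈ range (2 * c' + 1 + 1), ((2 * c' + 1 - j).factorial : ℝ) • (if D - 4 < j then 0 else g j)) = 0 := by
    refine sum_eq_zero fun j _ => ?_
    split_ifs with h
    · rw [smul_zero]
    · rw [hg0 j (by omega), smul_zero]
  simp only [hqG, Pi.zero_apply, zero_mul, sum_const_zero, mul_zero, add_zero] at htr
  -- norms: `Σ G² ≤ Σ F² ≤ Σ f²`
  have hGf : ∑ U ∈ univ.powersetCard (2 * c' + 1), G U ^ 2 ≤ ∑ U ∈ univ.powersetCard (2 * c' + 1), f U ^ 2 := by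
    have h2 : ∑ U ∈ univ.powersetCard (2 * c' + 1), F U ^ 2 ≤ ∑ U ∈ univ.powersetCard (2 * c' + 1), f U ^ 2 := by
      have h := (highPart_sum_eq_zero_and_sum_sq_le htn K p hp).2
      rw [← hfp] at h
      exact h
    refine le_trans (sum_le_sum fun U _ => ?_) h2
    show ((if Crosses U s(a, b) then (1 : ℝ) else 0) * F U) ^ 2 ≤ F U ^ 2
    split_ifs
    · rw [one_mul]
    · rw [zero_mul, zero_pow two_ne_zero]; exact sq_nonneg _
  have hPD := prod_atten_nonneg (n := n) (K := D - 4) (by omega)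
  have hCn : (0 : ℝ) < n.choose (2 * c' + 1) := by exact_mod_cast Nat.choose_pos (by omega)
  have hw0 : 0 ≤ ∑ c ∈ C, |w c| := sum_nonneg fun c _ => abs_nonneg _
  have hmono : Real.sqrt ((∏ i ∈ range ((D - 4) / 2 + 1), ((2 * i + 1 : ℝ) / ((n : ℝ) - 2 * i))) *
        ((∑ U ∈ univ.powersetCard (2 * c' + 1), G U ^ 2) / (n.choose (2 * c' + 1) : ℝ)) *
        ((∑ M : PMatch n, y M ^ 2) / (Fintype.card (PMatch n) : ℝ))) ≤
      Real.sqrt ((∏ i ∈ range ((D - 4) / 2 + 1), ((2 * i + 1 : ℝ) / ((n : ℝ) - 2 * i))) *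
        ((∑ U ∈ univ.powersetCard (2 * c' + 1), f U ^ 2) / (n.choose (2 * c' + 1) : ℝ)) *
        ((∑ M : PMatch n, y M ^ 2) / (Fintype.card (PMatch n) : ℝ))) :=
    Real.sqrt_le_sqrt (mul_le_mul_of_nonneg_right
      (mul_le_mul_of_nonneg_left (div_le_div_of_nonneg_right hGf hCn.le) hPD) (by positivity))
  rw [hV]
  exact htr.trans (mul_le_mul_of_nonneg_left hmono hw0)

end Summit.PneNP.PneNP.Theorems.ChebyshevTracialDesignCrossingPinWeighted
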